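import Mathlib
import HarnessLib
import HarnessLib.Audit
import Summits.NavierStokesRegularity.Statement
import Literature.Analysis.FluidPDE.ClassicalSolution
import Literature.Analysis.FluidPDE.LerayHopf
import Literature.Analysis.FluidPDE.NSWave0
import Summits.NavierStokesRegularity.NavierStokesRegularity.Theorems.ContinuousAlignmentNoBlowupToClay
import HarnessLib.Audit.Status.Attr

/-!
Route: L3TimeExponentPincer

# Route L3TimeExponentPincer — time-exponent pincer on the critical L3 axis — Euler-speed jaw (q<5)
against a supercritical Serrin partner (p>4)

It suffices to show X = K1 ∧ K2 on the tree's Leray–Hopf frame (classical NS solutions on [0,T),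
Leray–Hopf from a rapidly decaying
datum; frame of the PROVED item NoBlowupToClay, stmt-NavierStokesRegularity-0055). K1 = L3CascadeJaw
(ATTACKED conjunct, the cell
door D_Q of nsreg-p2 ROUND-2/3): for every q with 4 < q < 5 every frame solution has ∫_{T₂}^{T}
‖u(t)‖_{L³}^q dt < ∞ on some final
window — the integrated EULER-SPEED LAW ‖u(t)‖₃ ≲ (T−t)^{−1/5}. K2 = SupercriticalSerrinL3 (declared
RESIDUAL conjunct): for SOME p
with 4 < p < 5, u ∈ L^p_t L³_x up to T forces smooth extension past T (Escauriaza–Seregin–Šverák is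
p = ∞; p = 4 would be Clay itself).
The two exponents meet in (4,5): K1 hands K2 its hypothesis, K2 returns no blow-up, NoBlowupToClay
gives Clay (A).
Lean: `Summit.NavierStokesRegularity.NavierStokesRegularity.Theses.L3TimeExponentPincer.L3CascadeJaw
∧
Summit.NavierStokesRegularity.NavierStokesRegularity.Theses.L3TimeExponentPincer.SupercriticalSerrinL3`

## Assembly
Pure logic: take the exponent q ∈ (4,5) of SupercriticalSerrinL3; for any frame solution
L3CascadeJaw at that q supplies the
integrability hypothesis, SupercriticalSerrinL3 returns smooth extension past T, i.e. the antecedent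
of NoBlowupToClay; apply it.
The deciding theorem `closes` (glue.lean, 4 lines) elaborates; both open cruxes are load-bearing
binders.

Rationale: WHY THIS LINE. The critical L³ norm carries two integrability exponents with a gap: every Leray–Hopf
solution is a priori in L⁴_t L³_x (energy ×
enstrophy, interpolation ‖u‖₃⁴ ≤ ‖u‖₂²‖u‖₆²), while regularity is known only at L^∞_t L³_x (ESS
2003, Seregin 2012, Tao
arXiv:1908.04958); the same "known exponent vs needed exponent" gap drives Cheskidov–Shvydkoy's
dissipation-wavenumber programme
(arXiv:1102.1944: Λ ∈ L¹ a priori, L^{5/2} needed). The new lever is the CASCADE RATE: a complete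
energy cascade reaching scale r with
energy E at Euler speed has ‖u‖_∞ ≈ E^{1/5}(T−t)^{−3/5}, hence ‖u‖₃ ≲ (T−t)^{−1/5} and u ∈ L^q_t L³
for every q < 5; Tao's averaged
blow-up (arXiv:1402.0290) sits exactly at this speed, and the cell's ROUND-3 computation (order-zero
symbol damping of Tao's cascade,
Coiculescu arXiv:2307.15986 Thm 4.2 / Tao's hyperdissipation footnote) shows every SLOWER cascade is
realisable in the averaged class,
so K1 is averaged-false for every q > 4 and any proof must use non-averaged structure (flux
non-degeneracy: true NS has no small coupling
constants). Imported area: turbulence phenomenology (eddy turn-over causality, Onsager/Kolmogorov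
bookkeeping) made into a typed rate law;
no prior route or negatives entry uses a TIME-integrability exponent of a critical norm as the
pinched quantity (LebesgueExponentPincer
pinches the SPACE exponent q of sup_t ‖u‖_{L^q}; TypeICertificateLadder pinches sup-norm rates at
the Type-I line).

RANKED CRUXES. #2 L3CascadeJaw (crux) — L³ CASCADE JAW (door D_Q, attacked conjunct): for every q ∈
(4,5), every ν,T > 0 and every classical NS solution on [0,T) that is Leray–Hopf from a rapidly
decaying datum, there is T₂ ∈ (0,T) with ∫_{T₂}^{T} ‖u(t)‖_{L³}^q dt < ∞ (lower Lebesgue integral of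
eLpNorm^q finite). [difficulty: open-problem] (why it might fail: a true-NS blow-up whose cascade is
SLOWER than Euler speed (level-dependent depletion of the flux, as in the κ-damped averaged cascades
of ROUND-3, L³ rate 1/(5−2κ) > 1/5) violates it for q > 5−2κ; nothing proved forbids sub-Euler
flux.) [arXiv:1402.0290, arXiv:2307.15986, arXiv:1102.1944, arXiv:1908.04958]
#3 SupercriticalSerrinL3 (crux) — SUPERCRITICAL SERRIN ON THE L³ AXIS (declared residual conjunct):
there is p ∈ (4,5) such that every frame solution with ∫_{T₂}^{T} ‖u(t)‖_{L³}^p dt < ∞ on some final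
window extends smoothly past T. [difficulty: open-problem] (why it might fail: it contains Type-I
exclusion (a Type-I blow-up has L³ rate ≤ 1/6, so u ∈ L^p_tL³ for all p < 6 yet blows up) — Leray's
open question, hard core 0056; only p = ∞ (ESS) and triple-log rates (Tao 2019) are known.)
[arXiv:1908.04958, arXiv:1402.0290, arXiv:0709.3599, Seregin2012]
#9 NoBlowupToClay (support) — shared local-theory assembly (verbatim
stmt-NavierStokesRegularity-0055, PROVED in tree by
Theorems.continuousAlignment_noBlowupToClay_proof): NoBlowup in the Leray–Hopf frame → Clay (A).
[difficulty: provable-now] [Leray1934, Fefferman2000]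

TWO-LAYER PLAN. Foreseen split of L3CascadeJaw (registered birth skeleton
bc/L3CascadeJaw_birth.lean, composition PROVED): stub_supEulerSpeedLaw
(every frame solution has ‖u(t,x)‖ ≤ K (T−t)^{−3/5} near T — the sup-norm Euler-speed law; hardest)
→ stub_supRateToL3Rate (energy
interpolation ‖v‖₃³ ≤ ‖v‖_∞‖v‖₂², provable-now) → L3CascadeJaw. Foreseen split of
SupercriticalSerrinL3 (bc/SupercriticalSerrinL3_birth.lean,
composition PROVED): stub_l3RateFloor (∃ θ₀ > 1/5: at a blow-up time ‖u(t)‖₃ ≥ c (T−t)^{−θ₀}, a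
power-law ESS) → stub_floorToDivergence
(provable-now) → SupercriticalSerrinL3 with p := max(1/θ₀, 9/2).

KILL CRITERIA. A refutation of L3CascadeJaw (a true Leray–Hopf classical solution with ∫^T ‖u‖₃^q =
∞ for some q < 5 — necessarily a blow-up with
sub-Euler cascade) closes the route (close --reason refuted:L3CascadeJaw) and kills the door D_Q of
the cell. A refutation of
SupercriticalSerrinL3 at every p < 5 (e.g. a Type-I blow-up for true NS) closes it too and
simultaneously settles Leray's question
negatively. Proved elsewhere that moots it: NoTypeII-type results (every blow-up is sup-Type-I)
imply L3CascadeJaw outright (rung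
L3CascadeJaw_of_typeI); any proof of Clay (A) moots everything.

NOT DECOMPOSED YET. The flux non-degeneracy mechanism behind stub_supEulerSpeedLaw (Littlewood–Paley
energy-flux lower bounds at the active scale,
eddy turn-over causality, exclusion of energy FOCUSING from larger scales) is not typed: the tree
has no LP flux vocabulary for true NS
and the right statement (pointwise vs integrated, constants depending on E, ν) should be chosen by
the prover who attacks it. The
window bookkeeping (rate ⇒ integrability, floor ⇒ divergence) is proved or provable-now and stays
below item level.

CHEAPEST FALSIFIER. Exhibit ANY candidate true-NS blow-up mechanism surviving the energy class whose
L³ rate exceeds 1/5 — e.g. check whether the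
Hou–Luo / Elgindi-type self-similar scenarios transplanted to NS, or the discretely self-similar
cascades of Bradshaw–Tsai, have
‖u(t)‖₃ growing faster than (T−t)^{−1/5} (they are Type-I-like: rate ≤ 1/6, so they PASS — ran on
paper); the refuter's real test is
a convex-integration / cascade construction for TRUE NS with depleted flux. Lookup falsifier for K2:
a printed Type-I blow-up (none).

NUMBERS. Known a priori: u ∈ L⁴_t L³_x (energy level; ‖u‖₃⁴ ≤ ‖u‖₂²‖u‖₆² ≤ C E ‖∇u‖₂²). Needed
classically: L^∞_t L³_x (ESS). Euler-speed
cascade: ‖u‖_∞ ~ (T−t)^{−3/5}, ‖u‖₃ ~ (T−t)^{−1/5}, u ∈ L^q_tL³ ∀ q < 5 (Tao's cascade: q < 4.92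
with printed constants M = 100).
Damped averaged cascades (ROUND-3): L³ rate θ(κ) = 1/(5−2κ) ∈ [1/5, 1/4), threshold p_*(κ) = 5−2κ ↓
4 as κ ↑ 1/2 (α = 5/(5−2κ) ↑ 5/4,
Lions exponent). Type I: sup rate 1/2, L³ rate ≤ 1/6, u ∈ L^q_tL³ ∀ q < 6 (rung, proved).

DEFINITION REQUESTS. None: IsClassicalNSSolutionOn, IsLerayHopfOn, HasRapidSpatialDecay,
HasSmoothExtensionPast, eLpNorm, IsTypeIBlowup (rung) exist.

Novelty: Searches (2026-08-25): `lit search --hybrid "a priori estimate Leray-Hopf weak solutions higher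
derivatives energy scaling supercritical integrability critical L3 norm"` (8 books: Seregin14
pp78/166, RRS16 p121, Majda–Bertozzi, Foias–Manley–Rosa–Temam p115 — the energy-level tools, no
supercritical time-integrability claim); `lit search --hybrid "blow-up rate lower bound L3 norm
Navier-Stokes power law Seregin Escauriaza Sverak quantitative"` (8: Seregin14 pp129–131, RRS16
pp335–349, Lemarié-Rieusset16 p772 — ESS/Seregin and Leray's L^s rates s>3, no power-law L³ floor);
`lit vsearch "every Leray-Hopf solution satisfies an a priori bound in L^p(0,T; L^3) for some p
larger than 4"` (k=8: RRS16 p151, LR16 pp566–576 — none asserts p>4); `lit search "supercritical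
Serrin criterion" --source all` (local 8: arXiv:1012.0145 p3, arXiv:2101.08586 p3, arXiv:1102.1944
p11 log-improvements; remote: OpenAlex/S2 HTTP 429, arXiv 2, zbMATH 4, Crossref 8 — nothing on
L^p_tL³ with finite p); `lit galaxy search "L^p(0,T;L^3)|Lp(0,T;L3)|L^4(0,T;L^3)" --star all` (2
rows, noise: Morningside lectures vol., arXiv:1906.09914 atmosphere model); `lit galaxy search "rate
of blow-up of the L3|blow-up rate of the critical|L3 norm blows up" --star all` (0 rows); earlier
this session (memo ROUND-3 §6): galaxy "delayed cascade|slowed cascade", "dyadic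
Navier-Stokes|Katz-Pavlovic" (Cheskidov Trans. AMS 2008 = galaxy:pdf:1785924600, arXiv:1506.07480),
corpus arXiv:1402.0290 p8 footnote, arXiv:2307.15986 pp13–  [refs: 1012.0145, 2101.08586, 1102.1944, 1906.09914, 1506.07480, 1402.0290, 2307.15986]

Barriers (technique_class: cascade-rate, energy-identity, littlewood-paley, pincer): - technique_class: cascade-rate, energy-identity, littlewood-paley, harmonic-analysis,
critical-norm-integrability, pincer
- Literature.Barriers.NavierStokesRegularity.TaoAveragedBlowup: L3CascadeJaw is FALSE in Tao's
averaged class for every q > 4 (ROUND-3: κ-damped cascades, L³ rate 1/(5−2κ)); so the barrier bites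
any proof using only the energy identity + harmonic-analysis estimates of B; the line's declared
input is non-averaged (flux non-degeneracy of the true nonlinearity: no level-dependent small
coupling), i.e. it does not evade the barrier by technique class — the bet is that true NS obeys the
Euler-speed law that damped averaged models violate.
- Literature.Barriers.NavierStokesRegularity.HyperdissipativeAveragedBlowup: the α < 5/4 robustness
(Coiculescu Thm 4.2 / Tao footnote) is exactly the dictionary image of the damped family (α =
5/(5−2κ)); it places the whole range 4 < q < 5 of L3CascadeJaw inside averaged reach and certifies
that q = 4 (energy level) is averaged-sharp; evasion as above (none by class; fine structure
required).
- Literature.Barriers.NavierStokesRegularity.AveragedTypeIBlowup: an averaged Type-I blow-up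
satisfies L3CascadeJaw's integrability (rate ≤ 1/6) and violates SupercriticalSerrinL3 at every p;
it confirms that SupercriticalSerrinL3 (residual) cannot be proved by averaged-class means either
and that the ATTACKED conjunct is the one consistent with Type-I.
- Literature.Barriers.NavierStokesRegularity.EnergySupercriticality: L3CascadeJaw is

sub-problem: NavierStokesRegularity · status: open · opened planner-ns-regularity-ideate-p2-g5-0 2026-08-25T20:06:57Z · rev 6 · ledger route-NavierStokesRegularity-L3TimeExponentPincer
GENERATED by the gate from the ledger (D-0016/17). Provers cite these decls: `theorem foo : Summit.NavierStokesRegularity.NavierStokesRegularity.Theses.L3TimeExponentPincer.<Decl> := …` in Summits/NavierStokesRegularity/NavierStokesRegularity/Theorems/<Name>.lean.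
-/

namespace Summit.NavierStokesRegularity.NavierStokesRegularity.Theses.L3TimeExponentPincer

open scoped BigOperators Topology Manifold Classical MeasureTheory ProbabilityTheory Matrix InnerProductSpace ComplexConjugate ContinuousMap
open Filter Set Function TopologicalSpace MeasureTheory

attribute [summit_statement] _root_.NavierStokesRegularity

open Literature.NS

/-- item stmt-NavierStokesRegularity-19499 · crux · rank 2 · SPLIT (gen 1) into EffSatBlowup, JawSmoothBranch + glue L3CascadeJawOfSplit · direct attempts still welcome (low priority) · by planner
why it might fail: a true-NS blow-up whose cascade is SLOWER than Euler speed (level-dependent depletion of the flux, as in the κ-damped averaged cascades of ROUND-3, L³ rate 1/(5−2κ) > 1/5) violates it for q > 5−2κ; nothing proved forbids sub-Euler flux.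
sources: arXiv:1402.0290, arXiv:2307.15986, arXiv:1102.1944, arXiv:1908.04958
[crux] L³ CASCADE JAW (door D_Q, attacked conjunct): for every q ∈ (4,5), every ν,T > 0 and every
classical NS solution on [0,T) that is Leray–Hopf from a rapidly decaying datum, there is T₂ ∈ (0,T)
with ∫_{T₂}^{T} ‖u(t)‖_{L³}^q dt < ∞ (lower Lebesgue integral of eLpNorm^q finite). [difficulty:
open-problem] -/
@[route_item "route-NavierStokesRegularity-L3TimeExponentPincer", crux]
def L3CascadeJaw : Prop :=
  ∀ q : ℝ, 4 < q → q < 5 → ∀ (ν T : ℝ), 0 < ν → 0 < T → ∀ (u : ℝ → EuclideanSpace ℝ (Fin 3) → EuclideanSpace ℝ (Fin 3)) (p : ℝ → EuclideanSpace ℝ (Fin 3) → ℝ), Literature.Analysis.FluidPDE.IsClassicalNSSolutionOn (Set.Ico 0 T) ν 0 u p → Literature.Analysis.FluidPDE.IsLerayHopfOn T ν 0 (u 0) u → Literature.Analysis.FluidPDE.HasRapidSpatialDecay (u 0) → ∃ T₂ ∈ Set.Ioo 0 T, (∫⁻ t in Set.Ioo T₂ T, MeasureTheory.eLpNorm (u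 t) 3 MeasureTheory.volume ^ q) < ⊤

-- parent: L3CascadeJaw · child (gen 1)
/--     item stmt-NavierStokesRegularity-19139 · crux · rank 201 · open
    parent: L3CascadeJaw · by operator
    why it might fail: Stronger than the parent on the blow-up branch: a genuine NS blow-up could leak energy to large scales (ζₓ+13θ ≤ 3) or idle unboundedly between cascade steps while still obeying the jaw; both behaviours occur in Tao's averaged-NS blow-up, and no non-averaged mechanism excluding them is known.
    sources: arXiv:1402.0290, arXiv:1908.04958, doi:10.1017/9781139095143
[crux, hard child of L3CascadeJaw] EFFECTIVE-SCALE SATURATION K₃(1) ON THE BLOW-UP BRANCH: a frame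
solution with NO smooth extension past T carries, uniformly for t near T, an L³-effective FAT BALL —
some ball B(x₀,r) with r ≥ R₀·U·(T−t), U ≥ ‖u(t)‖₃³/L, holding kinetic energy ≥ m·U²·r³ (an
Euler-paced, non-idling, non-leaking cascade in the L³-effective sense). Verbatim (definitionally
equal) twin of the tree node
`Summit.NavierStokesRegularity.NavierStokesRegularity.Theorems.L3TimeExponentPincerEffNode.EffSatBlowup`
(@[conjecture], p414000; BC7 probe CLEAN, P5 not-summit) = hard stub `stub_effSaturation_blowup` of
line EffSat. With JawSmoothBranch it gives L3CascadeJaw via the landed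
`l3CascadeJaw_of_effSatBlowup` (p414110). Declared extra obligations beyond the parent (nsreg-p2
ROUND-7 §4, Addendum A): (β) energy non-leakage of the L³-carrying structure (over-attack wedge
W(1): θ ≤ 1/5, ζₓ+13θ > 3 on the (α,ζₓ,ζₜ)-chart), (γ) bounded idling; averaged-class FALSE (Tao
2016 cascade realises both failure modes), so any proof uses the energy identity / non-averaged
structure. -/
@[route_item "route-NavierStokesRegularity-L3TimeExponentPincer", crux]
def EffSatBlowup : Prop :=
  ∀ (ν T : ℝ), 0 < ν → 0 < T → ∀ (u : ℝ → EuclideanSpace ℝ (Fin 3) → EuclideanSpace ℝ (Fin 3)) (p : ℝ → EuclideanSpace ℝ (Fin 3) → ℝ), Literature.Analysis.FluidPDE.IsClassicalNSSolutionOn (Set.Ico 0 T) ν 0 u p → Literature.Analysis.FluidPDE.IsLerayHopfOn T ν 0 (u 0) u → Literature.Analysis.FluidPDE.HasRapidSpatialDecay (u 0) → ¬ Literature.Analysis.FluidPDE.HasSmoothExtensionPast ν 0 u T → ∃ m : ℝ, 0 < m ∧ ∃ R₀ : ℝ, 0 < R₀ ∧ ∃ L : ℝ, 0 < L ∧ ∃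 T₁ < T, ∀ t ∈ Set.Ioo T₁ T, ∃ U : ℝ, 0 ≤ U ∧ MeasureTheory.eLpNorm (u t) 3 MeasureTheory.volume ^ (3 : ℝ) ≤ ENNReal.ofReal (L * U) ∧ ∃ x₀ : EuclideanSpace ℝ (Fin 3), ∃ r : ℝ, R₀ * U * (T - t) ≤ r ∧ ENNReal.ofReal (m * (U ^ 2 * r ^ 3)) ≤ ∫⁻ x in Metric.ball x₀ r, ‖u t x‖ₑ ^ 2

-- parent: L3CascadeJaw · child (gen 1)
/--     item stmt-NavierStokesRegularity-19140 · support · rank 202 · closed · proved by Summit.NavierStokesRegularity.NavierStokesRegularity.Theorems.L3TimeExponentPincerJawSmoothBranch.jawSmoothBranch_item (planner)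
    parent: L3CascadeJaw · by operator
    sources: doi:10.1017/9781139095143
[support, PROVED child of L3CascadeJaw] the jaw on the SMOOTH branch: below a regular time T (smooth
extension past T exists) ‖u(t)‖₃ is bounded near T (closed-slab Leray–Hopf/Tao bounds), so
∫_{T₂}^{T} ‖u‖₃^q < ∞ for every q. Verbatim twin of
`Summit.NavierStokesRegularity.NavierStokesRegularity.Theorems.L3TimeExponentPincerSmoothBranch.JawSmoothBranch`,
PROVED there as `jawSmoothBranch_holds` (p414110): close this item with `exact
jawSmoothBranch_holds`. -/
@[route_item "route-NavierStokesRegularity-L3TimeExponentPincer"]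
def JawSmoothBranch : Prop :=
  ∀ q : ℝ, 4 < q → q < 5 → ∀ (ν T : ℝ), 0 < ν → 0 < T → ∀ (u : ℝ → EuclideanSpace ℝ (Fin 3) → EuclideanSpace ℝ (Fin 3)) (p : ℝ → EuclideanSpace ℝ (Fin 3) → ℝ), Literature.Analysis.FluidPDE.IsClassicalNSSolutionOn (Set.Ico 0 T) ν 0 u p → Literature.Analysis.FluidPDE.IsLerayHopfOn T ν 0 (u 0) u → Literature.Analysis.FluidPDE.HasRapidSpatialDecay (u 0) → Literature.Analysis.FluidPDE.HasSmoothExtensionPast ν 0 u T → ∃ T₂ ∈ Set.Ioo 0 T, (∫⁻ t in Set.Ioo T₂ T, MeasureTheory.eLpNorm (u t) 3 MeasureTheory.volume ^ q) < ⊤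

-- `JawSmoothBranch` holds: proved by `Summit.NavierStokesRegularity.NavierStokesRegularity.Theorems.L3TimeExponentPincerJawSmoothBranch.jawSmoothBranch_item` (its module imports this route file, so no `_holds` link can be stated here).

-- parent: L3CascadeJaw · glue (gen 1)
/--     item stmt-NavierStokesRegularity-19141 · support · rank 203 · closed · proved by Summit.NavierStokesRegularity.NavierStokesRegularity.Theorems.L3TimeExponentPincerSplitGlue.l3CascadeJawOfSplit_item (planner)
    parent: L3CascadeJaw · GLUE: children ⟹ parent · by operator
EffSatBlowup → JawSmoothBranch → L3CascadeJaw (fun h _ => l3CascadeJaw_of_effSatBlowup h, p414110) -/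
@[route_item "route-NavierStokesRegularity-L3TimeExponentPincer"]
def L3CascadeJawOfSplit : Prop :=
  EffSatBlowup → JawSmoothBranch → L3CascadeJaw

-- `L3CascadeJawOfSplit` holds: proved by `Summit.NavierStokesRegularity.NavierStokesRegularity.Theorems.L3TimeExponentPincerSplitGlue.l3CascadeJawOfSplit_item` (its module imports this route file, so no `_holds` link can be stated here).

/-- item stmt-NavierStokesRegularity-19500 · crux · rank 3 · open · by planner
why it might fail: it contains Type-I exclusion (a Type-I blow-up has L³ rate ≤ 1/6, so u ∈ L^p_tL³ for all p < 6 yet blows up) — Leray's open question, hard core 0056; only p = ∞ (ESS) and triple-log rates (Tao 2019) are known.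
sources: arXiv:1908.04958, arXiv:1402.0290, arXiv:0709.3599, Seregin2012
[crux] SUPERCRITICAL SERRIN ON THE L³ AXIS (declared residual conjunct): there is p ∈ (4,5) such
that every frame solution with ∫_{T₂}^{T} ‖u(t)‖_{L³}^p dt < ∞ on some final window extends smoothly
past T. [difficulty: open-problem] -/
@[route_item "route-NavierStokesRegularity-L3TimeExponentPincer", crux]
def SupercriticalSerrinL3 : Prop :=
  ∃ q : ℝ, 4 < q ∧ q < 5 ∧ ∀ (ν T : ℝ), 0 < ν → 0 < T → ∀ (u : ℝ → EuclideanSpace ℝ (Fin 3) → EuclideanSpace ℝ (Fin 3)) (p : ℝ → EuclideanSpace ℝ (Fin 3) → ℝ), Literature.Analysis.FluidPDE.IsClassicalNSSolutionOn (Set.Ico 0 T) ν 0 u p → Literature.Analysis.FluidPDE.IsLerayHopfOn T ν 0 (u 0) u → Literature.Analysis.FluidPDE.HasRapidSpatialDecay (u 0) → (∃ T₂ ∈ Set.Ioo 0 T, (∫⁻ t in Set.Ioo T₂ T, MeasureTheory.eLpNorm (u t) 3 MeasureTheory.volume ^ q) < ⊤) → Literature.Analysis.FluidPDE.HasSmoothExtensionPast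 ν 0 u T

/-- item stmt-NavierStokesRegularity-19501 · support · rank 9 · closed · proved by Summit.NavierStokesRegularity.NavierStokesRegularity.Theorems.L3TimeExponentPincerNoBlowupToClay.noBlowupToClay_item (planner) · by planner
sources: Leray1934, Fefferman2000
[support] shared local-theory assembly (verbatim stmt-NavierStokesRegularity-0055, PROVED in tree by
Theorems.continuousAlignment_noBlowupToClay_proof): NoBlowup in the Leray–Hopf frame → Clay (A).
[difficulty: provable-now] -/
@[route_item "route-NavierStokesRegularity-L3TimeExponentPincer", crux]
def NoBlowupToClay : Prop :=
  (∀ (ν T : ℝ), 0 < ν → 0 < T → ∀ (u : ℝ → EuclideanSpace ℝ (Fin 3) → EuclideanSpace ℝ (Fin 3)) (p : ℝ → EuclideanSpace ℝ (Fin 3) → ℝ), Literature.Analysis.FluidPDE.IsClassicalNSSolutionOn (Set.Ico 0 T) ν 0 u p → Literature.Analysis.FluidPDE.IsLerayHopfOn T ν 0 (u 0) u → Literature.Analysis.FluidPDE.HasRapidSpatialDecay (u 0) → Literature.Analysis.FluidPDE.HasSmoothExtensionPast ν 0 u T) → NavierStokesRegularity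

-- `NoBlowupToClay` holds: proved by `Summit.NavierStokesRegularity.NavierStokesRegularity.Theorems.L3TimeExponentPincerNoBlowupToClay.noBlowupToClay_item` (its module imports this route file, so no `_holds` link can be stated here).

/-- item stmt-NavierStokesRegularity-19502 · assembly · rank 1 · closed · proved by Summit.NavierStokesRegularity.NavierStokesRegularity.Theorems.l3TimeExponentPincer_assembly_proof (prover) · by planner
sources: Fefferman2000, arXiv:1402.0290
[assembly] L3CascadeJaw → SupercriticalSerrinL3 → NoBlowupToClay → NavierStokesRegularity. -/
@[route_item "route-NavierStokesRegularity-L3TimeExponentPincer"]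
def Assembly : Prop :=
  L3CascadeJaw → SupercriticalSerrinL3 → NoBlowupToClay → NavierStokesRegularity

-- `Assembly` holds: proved by `Summit.NavierStokesRegularity.NavierStokesRegularity.Theorems.l3TimeExponentPincer_assembly_proof` (its module imports this route file, so no `_holds` link can be stated here).

/-! D-0027 §2.1 — DECIDING THEOREM (planner-authored via `route open/edit --closes-file`; by operator:999:1934341 2026-08-26T07:45:23Z):
its hypotheses are this route's items and its conclusion the sub-problem Statement (glue_lint), and it elaborates with this file. -/

@[closes "route-NavierStokesRegularity-L3TimeExponentPincer"] theorem closes (h₁ : L3CascadeJaw) (h₂ : SupercriticalSerrinL3) (h₃ : NoBlowupToClay) :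
    NavierStokesRegularity := by
  obtain ⟨q, hq4, hq5, hK⟩ := h₂
  exact h₃ fun ν T hν hT u p hcl hLH hdec =>
    hK ν T hν hT u p hcl hLH hdec (h₁ q hq4 hq5 ν T hν hT u p hcl hLH hdec)

end Summit.NavierStokesRegularity.NavierStokesRegularity.Theses.L3TimeExponentPincer
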